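import Mathlib
import HarnessLib
import Literature.Computability.Complexity.RandomKSatPhiLowerBound
import Summits.Ventures.LatticeQCDFlow.Exactness.NCMCGeneralSpaceOverlap

/-!
# Pinsker's floor on the switch acceptance from the mean dissipated work, on a general state space

HONEST FRAMING: exact (Metropolis-corrected) sampling algorithms for lattice gauge theory;
figures of merit are autocorrelation/cost numbers at stated couplings and volumes; no
continuum-physics claim.

Venture `LatticeQCDFlow` (cell pub-lqcd), topic `Exactness`; FANOUT row 13 (`eng-snf`, GEN-12).
NEW WORK of the cell (general measure theory and one-variable calculus, elementary), not a
published result; nothing is cited as a fact (the inequality `TV ≤ √(KL/2)` is Pinsker 1964 /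
Csiszár 1967 / Kullback 1967, Tsybakov's Lemma 2.5, named only — it is re-proved here from scratch
in the cell's variables, Mathlib having no Pinsker inequality at this time).  Setting of
`NCMCGeneralSpaceOverlap.lean`: a Crooks pair from `ν₀` to `ν₁`, `P_F`, `P_R`, `e^{−ΔF} = Z₁/Z₀`, the
mean switch acceptance at `c = ΔF`, `acc = E_{P_F}[min(1, e^{−(W−ΔF)})] = 1 − TV(P_F, P_R)`
(`one_sub_accept_eq_half_integral_abs`), and the density `d = dP_R/dP_F = e^{ΔF − W}`.

WHY.  `NCMCGeneralSpaceAcceptanceFloor.lean` (GEN-10) gives the Bretagnolle–Huber floor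
`acc ≥ 1 − √(1 − e^{−⟨W_d⟩})` from the mean dissipated work alone.  Pinsker's floor
`acc ≥ 1 − √(⟨W_d⟩/2)` is the better of the two exactly when `⟨W_d⟩/2 < 1 − e^{−⟨W_d⟩}`, i.e. for
`⟨W_d⟩ < 1.59…` — the whole high-acceptance regime the engine's protocols are tuned for.  For
orientation only (not typed): `⟨W_d⟩ = 0.35` forces `acc ≥ 0.58` here against `0.46` from
Bretagnolle–Huber (and `0.68` from the Gaussian-work dictionary).

## Content

* `hasDerivAt_pinskerAux`, `hasDerivAt_pinskerAux_deriv` — derivatives of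
  `h(u) = (4 + 2u) φ(u) − 3(u − 1)²`, `φ(u) = u log u − u + 1 ≥ 0` (the tree's
  `Literature.Computability.Complexity.RandomKSat.mul_log_sub_ge_neg_one`, reused), and of `h'`;
  **`three_mul_sq_sub_one_le`** — THE POINTWISE INEQUALITY `3(u − 1)² ≤ (4 + 2u)(u log u − u + 1)`
  for `u ≥ 0` (`h(1) = h'(1) = 0`, `h'' = 4(log u + 1/u − 1) ≥ 0`, monotonicity of `h'` and of `h` on
  `(0,1]`, `[1,∞)` via `monotoneOn_of_hasDerivWithinAt_nonneg`); `abs_one_sub_le_linear` — its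
  linearisation `|1 − u| ≤ (t(4 + 2u)/3 + φ(u)/t)/2` for every `t > 0` (AM–GM).
* **`sq_integral_abs_one_sub_le`** — PINSKER IN DENSITY FORM: on a probability space, for `d ≥ 0`
  with `∫ d = 1` and `d`, `d log d` integrable, `(∫ |1 − d|)² ≤ 2 ∫ d log d`
  (integrate the linearisation: `X ≤ t + K/(2t)` for all `t > 0`, then `t = X/2`; no product
  integrability is needed).
* `CrooksPair.integral_density_mul`, `CrooksPair.integrable_density_mul_iff` — change of measure
  `E_F[e^{ΔF−W} φ] = E_R[φ]` and the matching integrability transfer.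
* **`CrooksPair.sq_one_sub_accept_le_half_rev_dissipation`** / **`…_le_half_dissipation`** —
  PINSKER FOR NON-EQUILIBRIUM SWITCHES: `(1 − acc)² ≤ ½ ⟨W_d⟩_R` and `(1 − acc)² ≤ ½ ⟨W_d⟩_F`, with
  `⟨W_d⟩_R = ΔF − E_{P_R}[W]` (`= KL(P_R‖P_F)`, `P_R`-integrable work) and `⟨W_d⟩_F = E_{P_F}[W] − ΔF`
  (`= KL(P_F‖P_R)`, `P_F`-integrable work; the pair read backwards has the same acceptance);
  **`CrooksPair.one_sub_sqrt_half_dissipation_le_accept`** / `…_rev_…` — `acc ≥ 1 − √(⟨W_d⟩/2)`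
  for either lane; `CrooksPair.abs_measureReal_sub_le_sqrt_half_dissipation` — the total-variation
  form `|P_F(A) − P_R(A)| ≤ √(min(⟨W_d⟩_F, ⟨W_d⟩_R)/2)` for every measurable `A`.

Nothing is claimed about any VALUE for a concrete protocol; the floors need an integrable work on
the lane used and nothing else (no Gaussianity, no variance).
-/

namespace Summit.Ventures.LatticeQCDFlow.Exactness.GeneralNCMC

open MeasureTheory ProbabilityTheory Set Filter
open scoped ENNReal

variable {Ω E : Type*} [MeasurableSpace Ω] [MeasurableSpace E]

/-! ## The pointwise inequality behind Pinsker: `3(u − 1)² ≤ (4 + 2u)(u log u − u + 1)` -/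

-- `φ(u) = u log u − u + 1 ≥ 0` for `u ≥ 0` is the tree's
-- `Literature.Computability.Complexity.RandomKSat.mul_log_sub_ge_neg_one` (folklore; reused, not restated).

/-- The auxiliary function `h(u) = (4 + 2u)(u log u − u + 1) − 3(u − 1)²` has derivative
`g(u) = 4u log u + 4 log u − 8u + 8` at every `u ≠ 0`. -/
theorem hasDerivAt_pinskerAux {u : ℝ} (hu : u ≠ 0) :
    HasDerivAt (fun x => (4 + 2 * x) * (x * Real.log x - x + 1) - 3 * (x - 1) ^ 2)
      (4 * (u * Real.log u) + 4 * Real.log u - 8 * u + 8) u := by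
  have h1 : HasDerivAt (fun x => 4 + 2 * x) (2 * 1) u :=
    ((hasDerivAt_id u).const_mul 2).const_add 4
  have h2 : HasDerivAt (fun x => x * Real.log x - x + 1) (Real.log u + 1 - 1) u :=
    ((Real.hasDerivAt_mul_log hu).fun_sub (hasDerivAt_id u)).add_const 1
  have h3 : HasDerivAt (fun x => 3 * (x - 1) ^ 2) (3 * ((2 : ℕ) * (u - 1) ^ (2 - 1) * 1)) u :=
    (((hasDerivAt_id u).sub_const 1).fun_pow 2).const_mul 3
  refine ((h1.fun_mul h2).fun_sub h3).congr_deriv ?_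
  push_cast
  ring

/-- … and `g` has derivative `4 log u + 4/u − 4` at every `u ≠ 0`. -/
theorem hasDerivAt_pinskerAux_deriv {u : ℝ} (hu : u ≠ 0) :
    HasDerivAt (fun x => 4 * (x * Real.log x) + 4 * Real.log x - 8 * x + 8)
      (4 * Real.log u + 4 * u⁻¹ - 4) u := by
  have h1 : HasDerivAt (fun x => 4 * (x * Real.log x)) (4 * (Real.log u + 1)) u :=
    (Real.hasDerivAt_mul_log hu).const_mul 4
  have h2 : HasDerivAt (fun x => 4 * Real.log x) (4 * u⁻¹) u := (Real.hasDerivAt_log hu).const_mul 4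
  have h3 : HasDerivAt (fun x => 8 * x) (8 * 1) u := (hasDerivAt_id u).const_mul 8
  refine (((h1.fun_add h2).fun_sub h3).add_const 8).congr_deriv ?_
  ring

/-- **The pointwise inequality**: `3(u − 1)² ≤ (4 + 2u)(u log u − u + 1)` for every `u ≥ 0`
(`h(1) = h'(1) = 0` and `h'' = 4(log u + 1/u − 1) ≥ 0`). -/
theorem three_mul_sq_sub_one_le {u : ℝ} (hu : 0 ≤ u) :
    3 * (u - 1) ^ 2 ≤ (4 + 2 * u) * (u * Real.log u - u + 1) := by
  -- names for `h` and `g = h'`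
  set h : ℝ → ℝ := fun x => (4 + 2 * x) * (x * Real.log x - x + 1) - 3 * (x - 1) ^ 2 with hh
  set g : ℝ → ℝ := fun x => 4 * (x * Real.log x) + 4 * Real.log x - 8 * x + 8 with hg
  have hder : ∀ x, 0 < x → HasDerivAt h (g x) x := fun x hx => hasDerivAt_pinskerAux hx.ne'
  have gder : ∀ x, 0 < x → HasDerivAt g (4 * Real.log x + 4 * x⁻¹ - 4) x := fun x hx =>
    hasDerivAt_pinskerAux_deriv hx.ne'
  have g1 : g 1 = 0 := by simp [hg]
  have h1 : h 1 = 0 := by simp [hh]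
  -- `g` is monotone on `(0, ∞)`
  have gmono : MonotoneOn g (Ioi 0) := by
    refine monotoneOn_of_hasDerivWithinAt_nonneg (convex_Ioi 0)
      (f' := fun x => 4 * Real.log x + 4 * x⁻¹ - 4) ?_ ?_ ?_
    · exact fun x hx => (gder x hx).continuousAt.continuousWithinAt
    · intro x hx
      rw [interior_Ioi] at hx ⊢
      exact (gder x hx).hasDerivWithinAt
    · intro x hx
      rw [interior_Ioi] at hx
      have := Real.one_sub_inv_le_log_of_pos (show (0 : ℝ) < x from hx)
      linarith
  rcases hu.eq_or_lt with h0 | hpos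
  · rw [← h0]
    norm_num
  rcases le_total u 1 with hle | hge
  · -- on `(0, 1]` the function `h` is antitone, so `h u ≥ h 1 = 0`
    have hanti : AntitoneOn h (Ioc 0 1) := by
      refine antitoneOn_of_hasDerivWithinAt_nonpos (convex_Ioc 0 1) (f := h) (f' := g) ?_ ?_ ?_
      · exact fun x hx => (hder x hx.1).continuousAt.continuousWithinAt
      · intro x hx
        rw [interior_Ioc] at hx ⊢
        exact (hder x hx.1).hasDerivWithinAt
      · intro x hx
        rw [interior_Ioc] at hx
        have := gmono (Set.mem_Ioi.2 hx.1) (Set.mem_Ioi.2 one_pos) hx.2.le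
        rw [g1] at this
        exact this
    have key := hanti ⟨hpos, hle⟩ ⟨one_pos, le_rfl⟩ hle
    rw [h1] at key
    have : 0 ≤ h u := key
    simp only [hh] at this
    linarith
  · -- on `[1, ∞)` the function `h` is monotone, so `h u ≥ h 1 = 0`
    have hmono : MonotoneOn h (Ici 1) := by
      refine monotoneOn_of_hasDerivWithinAt_nonneg (convex_Ici 1) (f := h) (f' := g) ?_ ?_ ?_
      · exact fun x hx => (hder x (lt_of_lt_of_le one_pos hx)).continuousAt.continuousWithinAt
      · intro x hx
        rw [interior_Ici] at hx ⊢
        exact (hder x (lt_trans one_pos hx)).hasDerivWithinAt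
      · intro x hx
        rw [interior_Ici] at hx
        have := gmono (Set.mem_Ioi.2 one_pos) (Set.mem_Ioi.2 (lt_trans one_pos hx)) hx.le
        rw [g1] at this
        exact this
    have key := hmono (show (1 : ℝ) ∈ Ici (1 : ℝ) from Set.mem_Ici.2 le_rfl)
      (show u ∈ Ici (1 : ℝ) from Set.mem_Ici.2 hge) hge
    rw [h1] at key
    have : 0 ≤ h u := key
    simp only [hh] at this
    linarith

/-- **Linearised form**: for `u ≥ 0` and every `t > 0`,
`|1 − u| ≤ (t · (4 + 2u)/3 + (u log u − u + 1)/t) / 2` (`(1 − u)² ≤ a·b ≤ ((t a + b/t)/2)²`). -/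
theorem abs_one_sub_le_linear {u : ℝ} (hu : 0 ≤ u) {t : ℝ} (ht : 0 < t) :
    |1 - u| ≤ (t * ((4 + 2 * u) / 3) + (u * Real.log u - u + 1) / t) / 2 := by
  set a := (4 + 2 * u) / 3 with ha
  set b := u * Real.log u - u + 1 with hb
  have ha0 : 0 ≤ a := by rw [ha]; positivity
  have hb0 : 0 ≤ b := Literature.Computability.Complexity.RandomKSat.mul_log_sub_ge_neg_one hu
  have hab : (1 - u) ^ 2 ≤ a * b := by
    have := three_mul_sq_sub_one_le hu
    rw [ha, hb]
    nlinarith [this]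
  have hamgm : a * b ≤ ((t * a + b / t) / 2) ^ 2 := by
    have ht' : t ≠ 0 := ht.ne'
    have : 0 ≤ (t * a - b / t) ^ 2 := sq_nonneg _
    have hid : ((t * a + b / t) / 2) ^ 2 - a * b = ((t * a - b / t) / 2) ^ 2 := by
      field_simp
      ring
    nlinarith [hid, sq_nonneg ((t * a - b / t) / 2)]
  refine abs_le_of_sq_le_sq (hab.trans hamgm) ?_
  positivity

/-! ## Pinsker's inequality in density form -/

/-- **Pinsker, density form.**  On a probability space, for a non-negative integrable `d` with
`∫ d = 1` and `d log d` integrable: `(∫ |1 − d|)² ≤ 2 ∫ d log d`, i.e.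
`½‖μ − d·μ‖₁ ≤ √(KL(d·μ ‖ μ)/2)`.  Proof: integrate the linearised pointwise inequality
(`∫ (4 + 2d)/3 = 2`, `∫ (d log d − d + 1) = ∫ d log d`) to get `X ≤ t + K/(2t)` for every `t > 0`,
`X = ∫|1 − d|`, `K = ∫ d log d`, and take `t = X/2`. -/
theorem sq_integral_abs_one_sub_le {μ : Measure E} [IsProbabilityMeasure μ] {d : E → ℝ}
    (hd0 : ∀ x, 0 ≤ d x) (hdi : Integrable d μ) (hd1 : ∫ x, d x ∂μ = 1)
    (hdlog : Integrable (fun x => d x * Real.log (d x)) μ) :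
    (∫ x, |1 - d x| ∂μ) ^ 2 ≤ 2 * ∫ x, d x * Real.log (d x) ∂μ := by
  set X := ∫ x, |1 - d x| ∂μ with hX
  set K := ∫ x, d x * Real.log (d x) ∂μ with hK
  have hX0 : 0 ≤ X := integral_nonneg fun x => abs_nonneg _
  have hI : Integrable (fun x => d x * Real.log (d x) - d x) μ := hdlog.sub hdi
  have hφ : ∫ x, (d x * Real.log (d x) - d x + 1) ∂μ = K := by
    rw [integral_add hI (integrable_const 1), integral_sub hdlog hdi, hd1, integral_const, smul_eq_mul,
      probReal_univ, hK]
    ring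
  have hK0 : 0 ≤ K := by
    have : K = ∫ x, (d x * Real.log (d x) - d x + 1) ∂μ := hφ.symm
    rw [this]
    exact integral_nonneg fun x =>
      Literature.Computability.Complexity.RandomKSat.mul_log_sub_ge_neg_one (hd0 x)
  -- `X ≤ t + K/(2t)` for every `t > 0`
  have hlin : ∀ t : ℝ, 0 < t → X ≤ t + K / (2 * t) := by
    intro t ht
    have hA0 : Integrable (fun x => 4 + 2 * d x) μ := (integrable_const 4).add (hdi.const_mul 2)
    have hA : Integrable (fun x => t * ((4 + 2 * d x) / 3)) μ := (hA0.div_const 3).const_mul t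
    have hB0 : Integrable (fun x => d x * Real.log (d x) - d x + 1) μ := hI.add (integrable_const 1)
    have hB : Integrable (fun x => (d x * Real.log (d x) - d x + 1) / t) μ := hB0.div_const t
    have hle : X ≤ ∫ x, (t * ((4 + 2 * d x) / 3) + (d x * Real.log (d x) - d x + 1) / t) / 2 ∂μ :=
      integral_mono_of_nonneg (Eventually.of_forall fun x => abs_nonneg _) ((hA.add hB).div_const 2)
        (Eventually.of_forall fun x => abs_one_sub_le_linear (hd0 x) ht)
    have hval : ∫ x, (t * ((4 + 2 * d x) / 3) + (d x * Real.log (d x) - d x + 1) / t) / 2 ∂μ =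
        t + K / (2 * t) := by
      rw [integral_div, integral_add hA hB, integral_const_mul, integral_div, integral_div,
        integral_add (integrable_const 4) (hdi.const_mul 2), integral_const_mul, hd1, hφ,
        integral_const, smul_eq_mul, probReal_univ]
      field_simp
      ring
    rw [hval] at hle
    exact hle
  rcases hX0.eq_or_lt with hX00 | hXpos
  · rw [← hX00]
    simpa using hK0
  · have := hlin (X / 2) (by positivity)
    have hX' : X ≠ 0 := hXpos.ne'
    have h2 : K / (2 * (X / 2)) = K / X := by
      congr 1
      ring
    rw [h2] at this
    have h3 : X / 2 ≤ K / X := by linarith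
    rw [le_div_iff₀ hXpos] at h3
    nlinarith [h3]

/-! ## Pinsker for non-equilibrium switches -/

namespace CrooksPair

variable {ν₀ ν₁ : Measure Ω} {κF κR : Kernel Ω E} {s e : E → Ω} {W : E → ℝ}

/-- **Change of measure along Crooks**: `E_{P_F}[e^{ΔF − W} φ] = E_{P_R}[φ]` for every `φ` on records
(`dP_R/dP_F = e^{ΔF−W}`, `NCMCGeneralSpaceRelativeEntropy.revPathLaw_eq_withDensity`). -/
theorem integral_density_mul [IsFiniteMeasure ν₀] [IsFiniteMeasure ν₁] [IsMarkovKernel κR]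
    (h0 : ν₀ univ ≠ 0) (h1 : ν₁ univ ≠ 0) (h : CrooksPair ν₀ ν₁ κF κR s e W) {ΔF : ℝ}
    (hΔF : Real.exp (-ΔF) = ((ν₀ univ)⁻¹ * ν₁ univ).toReal) (φ : E → ℝ) :
    ∫ ε, Real.exp (ΔF - W ε) * φ ε ∂(fwdPathLaw ν₀ κF) = ∫ ε, φ ε ∂(fwdPathLaw ν₁ κR) := by
  have hd : Measurable fun ε => ENNReal.ofReal (Real.exp (ΔF - W ε)) :=
    (Real.measurable_exp.comp (measurable_const.sub h.measurable_W)).ennreal_ofReal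
  have hlt : ∀ᵐ ε ∂(fwdPathLaw ν₀ κF), ENNReal.ofReal (Real.exp (ΔF - W ε)) < ∞ :=
    Eventually.of_forall fun _ => ENNReal.ofReal_lt_top
  rw [h.revPathLaw_eq_withDensity h0 h1 hΔF, integral_withDensity_eq_integral_toReal_smul hd hlt]
  refine integral_congr_ae (Eventually.of_forall fun ε => ?_)
  simp only
  rw [ENNReal.toReal_ofReal (Real.exp_pos _).le, smul_eq_mul]

/-- … and `e^{ΔF − W} φ ∈ L¹(P_F)` iff `φ ∈ L¹(P_R)`. -/
theorem integrable_density_mul_iff [IsFiniteMeasure ν₀] [IsFiniteMeasure ν₁] [IsMarkovKernel κR]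
    (h0 : ν₀ univ ≠ 0) (h1 : ν₁ univ ≠ 0) (h : CrooksPair ν₀ ν₁ κF κR s e W) {ΔF : ℝ}
    (hΔF : Real.exp (-ΔF) = ((ν₀ univ)⁻¹ * ν₁ univ).toReal) (φ : E → ℝ) :
    Integrable (fun ε => Real.exp (ΔF - W ε) * φ ε) (fwdPathLaw ν₀ κF) ↔
      Integrable φ (fwdPathLaw ν₁ κR) := by
  have hd : Measurable fun ε => ENNReal.ofReal (Real.exp (ΔF - W ε)) :=
    (Real.measurable_exp.comp (measurable_const.sub h.measurable_W)).ennreal_ofReal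
  have hlt : ∀ᵐ ε ∂(fwdPathLaw ν₀ κF), ENNReal.ofReal (Real.exp (ΔF - W ε)) < ∞ :=
    Eventually.of_forall fun _ => ENNReal.ofReal_lt_top
  rw [h.revPathLaw_eq_withDensity h0 h1 hΔF, integrable_withDensity_iff hd hlt]
  have heq : (fun ε => φ ε * (ENNReal.ofReal (Real.exp (ΔF - W ε))).toReal) =
      fun ε => Real.exp (ΔF - W ε) * φ ε := by
    funext ε
    rw [ENNReal.toReal_ofReal (Real.exp_pos _).le, mul_comm]
  rw [heq]

/-- **Pinsker for non-equilibrium switches, reverse lane.**  For every Crooks pair with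
`e^{−ΔF} = Z₁/Z₀` and a `P_R`-integrable work, the rejection rate of the Metropolized switch at
`c = ΔF` satisfies `(1 − acc)² ≤ ½ (ΔF − E_{P_R}[W])` — half the REVERSE lane's mean dissipated work
(`= ½ KL(P_R ‖ P_F)`; `1 − acc = TV(P_F, P_R)`). -/
theorem sq_one_sub_accept_le_half_rev_dissipation [IsFiniteMeasure ν₀] [IsFiniteMeasure ν₁]
    [IsMarkovKernel κF] [IsMarkovKernel κR] (h0 : ν₀ univ ≠ 0) (h1 : ν₁ univ ≠ 0)
    (h : CrooksPair ν₀ ν₁ κF κR s e W) {ΔF : ℝ}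
    (hΔF : Real.exp (-ΔF) = ((ν₀ univ)⁻¹ * ν₁ univ).toReal)
    (hW : Integrable W (fwdPathLaw ν₁ κR)) :
    (1 - ∫ ε, min 1 (Real.exp (-(W ε - ΔF))) ∂(fwdPathLaw ν₀ κF)) ^ 2 ≤
      (ΔF - ∫ ε, W ε ∂(fwdPathLaw ν₁ κR)) / 2 := by
  haveI := isProbabilityMeasure_fwdPathLaw ν₀ h0 κF
  haveI := isProbabilityMeasure_fwdPathLaw ν₁ h1 κR
  -- the density `d = e^{ΔF − W}` of `P_R` against `P_F`
  have hdi : Integrable (fun ε => Real.exp (ΔF - W ε)) (fwdPathLaw ν₀ κF) := h.integrable_density h0 ΔF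
  have hd1 : ∫ ε, Real.exp (ΔF - W ε) ∂(fwdPathLaw ν₀ κF) = 1 := h.integral_density_eq_one hΔF
  -- `d log d = e^{ΔF−W} (ΔF − W)`, integrable iff `ΔF − W ∈ L¹(P_R)`
  have hlog : ∀ ε, Real.exp (ΔF - W ε) * Real.log (Real.exp (ΔF - W ε)) =
      Real.exp (ΔF - W ε) * (ΔF - W ε) := fun ε => by rw [Real.log_exp]
  have hWR : Integrable (fun ε => ΔF - W ε) (fwdPathLaw ν₁ κR) := (integrable_const ΔF).sub hW
  have hdlog : Integrable (fun ε => Real.exp (ΔF - W ε) * Real.log (Real.exp (ΔF - W ε)))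
      (fwdPathLaw ν₀ κF) := by
    simp_rw [hlog]
    exact (h.integrable_density_mul_iff h0 h1 hΔF _).2 hWR
  have hK : ∫ ε, Real.exp (ΔF - W ε) * Real.log (Real.exp (ΔF - W ε)) ∂(fwdPathLaw ν₀ κF) =
      ΔF - ∫ ε, W ε ∂(fwdPathLaw ν₁ κR) := by
    simp_rw [hlog]
    rw [h.integral_density_mul h0 h1 hΔF, integral_sub (integrable_const ΔF) hW, integral_const,
      smul_eq_mul, probReal_univ, one_mul]
  have hP := sq_integral_abs_one_sub_le (fun ε => (Real.exp_pos _).le) hdi hd1 hdlog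
  rw [hK] at hP
  have htv := h.one_sub_accept_eq_half_integral_abs h0 hΔF
  rw [htv]
  nlinarith [hP]

/-- **`acc ≥ 1 − √(⟨W_d⟩_R / 2)`**, `⟨W_d⟩_R = ΔF − E_{P_R}[W]` the reverse lane's mean dissipation —
Pinsker's floor on the switch acceptance, for every protocol certified as a Crooks pair with
`P_R`-integrable work. -/
theorem one_sub_sqrt_half_rev_dissipation_le_accept [IsFiniteMeasure ν₀] [IsFiniteMeasure ν₁]
    [IsMarkovKernel κF] [IsMarkovKernel κR] (h0 : ν₀ univ ≠ 0) (h1 : ν₁ univ ≠ 0)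
    (h : CrooksPair ν₀ ν₁ κF κR s e W) {ΔF : ℝ}
    (hΔF : Real.exp (-ΔF) = ((ν₀ univ)⁻¹ * ν₁ univ).toReal)
    (hW : Integrable W (fwdPathLaw ν₁ κR)) :
    1 - Real.sqrt ((ΔF - ∫ ε, W ε ∂(fwdPathLaw ν₁ κR)) / 2) ≤
      ∫ ε, min 1 (Real.exp (-(W ε - ΔF))) ∂(fwdPathLaw ν₀ κF) := by
  have hsq := h.sq_one_sub_accept_le_half_rev_dissipation h0 h1 hΔF hW
  have := Real.le_sqrt_of_sq_le hsq
  linarith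

/-- **Pinsker for non-equilibrium switches, forward lane**: for a `P_F`-integrable work,
`(1 − acc)² ≤ ½ (E_{P_F}[W] − ΔF)` — half the FORWARD lane's mean dissipated work
(`= ½ KL(P_F ‖ P_R)`; the pair read backwards has the same acceptance). -/
theorem sq_one_sub_accept_le_half_dissipation [IsFiniteMeasure ν₀] [IsFiniteMeasure ν₁]
    [IsMarkovKernel κF] [IsMarkovKernel κR] (h0 : ν₀ univ ≠ 0) (h1 : ν₁ univ ≠ 0)
    (h : CrooksPair ν₀ ν₁ κF κR s e W) {ΔF : ℝ}
    (hΔF : Real.exp (-ΔF) = ((ν₀ univ)⁻¹ * ν₁ univ).toReal)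
    (hW : Integrable W (fwdPathLaw ν₀ κF)) :
    (1 - ∫ ε, min 1 (Real.exp (-(W ε - ΔF))) ∂(fwdPathLaw ν₀ κF)) ^ 2 ≤
      (∫ ε, W ε ∂(fwdPathLaw ν₀ κF) - ΔF) / 2 := by
  have hs := h.symm.sq_one_sub_accept_le_half_rev_dissipation h1 h0 (exp_freeEnergyDiff h0 h1 hΔF)
    hW.neg
  have hacc : ∫ ε, min 1 (Real.exp (-(-W ε - -ΔF))) ∂(fwdPathLaw ν₁ κR) =
      ∫ ε, min 1 (Real.exp (-(W ε - ΔF))) ∂(fwdPathLaw ν₀ κF) := by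
    rw [← h.integral_accept_rev_eq h0 h1 hΔF]
    refine integral_congr_ae (Eventually.of_forall fun ε => ?_)
    simp only
    rw [show -(-W ε - -ΔF) = W ε - ΔF by ring]
  rw [hacc, integral_neg] at hs
  have hexp : (-ΔF - -∫ ε, W ε ∂(fwdPathLaw ν₀ κF)) = ∫ ε, W ε ∂(fwdPathLaw ν₀ κF) - ΔF := by ring
  rw [hexp] at hs
  exact hs

/-- **`acc ≥ 1 − √(⟨W_d⟩_F / 2)`**, `⟨W_d⟩_F = E_{P_F}[W] − ΔF` the forward lane's mean dissipated work
— Pinsker's floor for every protocol certified as a Crooks pair with `P_F`-integrable work.  It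
improves the Bretagnolle–Huber floor `1 − √(1 − e^{−⟨W_d⟩})` of `NCMCGeneralSpaceAcceptanceFloor.lean`
exactly when `⟨W_d⟩/2 < 1 − e^{−⟨W_d⟩}`, i.e. for `⟨W_d⟩ < 1.59…` (the high-acceptance regime). -/
theorem one_sub_sqrt_half_dissipation_le_accept [IsFiniteMeasure ν₀] [IsFiniteMeasure ν₁]
    [IsMarkovKernel κF] [IsMarkovKernel κR] (h0 : ν₀ univ ≠ 0) (h1 : ν₁ univ ≠ 0)
    (h : CrooksPair ν₀ ν₁ κF κR s e W) {ΔF : ℝ}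
    (hΔF : Real.exp (-ΔF) = ((ν₀ univ)⁻¹ * ν₁ univ).toReal)
    (hW : Integrable W (fwdPathLaw ν₀ κF)) :
    1 - Real.sqrt ((∫ ε, W ε ∂(fwdPathLaw ν₀ κF) - ΔF) / 2) ≤
      ∫ ε, min 1 (Real.exp (-(W ε - ΔF))) ∂(fwdPathLaw ν₀ κF) := by
  have hsq := h.sq_one_sub_accept_le_half_dissipation h0 h1 hΔF hW
  have := Real.le_sqrt_of_sq_le hsq
  linarith

/-- **Total-variation form**: for every measurable set of records `A`,
`|P_F(A) − P_R(A)| ≤ √(min(⟨W_d⟩_F, ⟨W_d⟩_R) / 2)` (both works integrable). -/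
theorem abs_measureReal_sub_le_sqrt_half_dissipation [IsFiniteMeasure ν₀] [IsFiniteMeasure ν₁]
    [IsMarkovKernel κF] [IsMarkovKernel κR] (h0 : ν₀ univ ≠ 0) (h1 : ν₁ univ ≠ 0)
    (h : CrooksPair ν₀ ν₁ κF κR s e W) {ΔF : ℝ}
    (hΔF : Real.exp (-ΔF) = ((ν₀ univ)⁻¹ * ν₁ univ).toReal)
    (hWF : Integrable W (fwdPathLaw ν₀ κF)) (hWR : Integrable W (fwdPathLaw ν₁ κR)) {A : Set E}
    (hA : MeasurableSet A) :
    |(fwdPathLaw ν₀ κF).real A - (fwdPathLaw ν₁ κR).real A| ≤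
      Real.sqrt (min (∫ ε, W ε ∂(fwdPathLaw ν₀ κF) - ΔF) (ΔF - ∫ ε, W ε ∂(fwdPathLaw ν₁ κR)) / 2) := by
  have htv := h.abs_measureReal_sub_le_one_sub_accept h0 h1 hΔF hA
  have hF := h.one_sub_sqrt_half_dissipation_le_accept h0 h1 hΔF hWF
  have hR := h.one_sub_sqrt_half_rev_dissipation_le_accept h0 h1 hΔF hWR
  rcases le_total (∫ ε, W ε ∂(fwdPathLaw ν₀ κF) - ΔF) (ΔF - ∫ ε, W ε ∂(fwdPathLaw ν₁ κR)) with hle | hle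
  · rw [min_eq_left hle]
    linarith
  · rw [min_eq_right hle]
    linarith

end CrooksPair

end Summit.Ventures.LatticeQCDFlow.Exactness.GeneralNCMC
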